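import Summits.ValiantsHypothesis.ValiantsHypothesis.Theorems.LacunarySymmetroidMatrixDescartesFiniteSector

/-!
# `MatrixDescartes` — line «finite»: the SECTOR CEILING at `(3,4)` in closed form, `η(3,4) ≤ σ(3,4) = 30` (kernel) — hence `η(3,4) = 30` EXACT

HONEST FRAMING.  Object-search cell `pub-symmetroid`, seat val-sym-door-p5 g7 (desk go-in-principle R2488 (A): «same offer for `HypRootLawAt 3 4 30`»).
HELPER of the crux item `stmt-ValiantsHypothesis-18050` (`Theses.LacunarySymmetroid.MatrixDescartes`) with NO closure claim.  The `(3,4)` twin of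
`…FiniteSectorSectorCeilingMTwo` (`HypRootLawAt 2 6 32`): for `m = 3` the SIEVE (`FiniteSector.sieve`, `natDegree_mem_sumset`) speaks of TRIPLE SUMS
`dᵢ + dⱼ + dₖ`; a step-≤-2 chain of triple sums from `0` to the degree forces the value `0`; values are capped at `33`, the value set padded to four and
sorted, and ONE pruned nested kernel check (`sectorCheck_three_four`, `decide +kernel`, no definitions introduced) shows the chain cannot carry a degree
above `30`: `hypRootLawAt_three_four_30 : HypRootLawAt 3 4 30`.  Located first (stdlib exact enumeration over all 4-sets `∋ 0` in `[0,33]`, 5 456 sets):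
the maximal chain is attained ONLY by `{0,2,8,10} = 2·{0,1,4,5}` — the doubled `F6` basis.  LOWER SIDE BY NAME is already in the tree: `not_hypRootLawAt_three_four_29`
(…FiniteSectorStampCeilingThreeFour, p611253: val-sym-eng-3 g4's `F6` realisation `ν(3,4) = 15` doubled; not imported here only to avoid a build-order
wait), so with this file **`η(3,4) = 30` EXACT ON BOTH SIDES BY NAME** (`hypRootLawAt_three_four_30` ∧ `not_hypRootLawAt_three_four_29`).  Nothing here bears on the crux (asymptotic), on `H3`, on the doors, or on `VP ≠ VNP`.
[folklore] Gap-rule / sieve bookkeeping plus a finite enumeration; no citation is load-bearing.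
-/

-- `Summit.ValiantsHypothesis.ValiantsHypothesis.…` repeats a component by the D-0017 layout
-- (single-conjunct summit), which the `dupNamespace` linter flags; the name is mandated.
set_option linter.dupNamespace false

namespace Summit.ValiantsHypothesis.ValiantsHypothesis.Theorems.LacunarySymmetroidMatrixDescartes.FiniteSector

open scoped BigOperators Matrix
open Polynomial

/-- **Prefix pruning for triple sums.**  If every element of `l₂` is `≥ x`, a triple sum `r < x` of `l₁ ++ l₂` is already a triple sum of `l₁`. [folklore] -/
theorem memP3_prefix {l₁ l₂ : List ℕ} {x r : ℕ} (hx : ∀ y ∈ l₂, x ≤ y) (hr : r < x) :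
    (∃ p ∈ l₁ ++ l₂, ∃ q ∈ l₁ ++ l₂, ∃ s ∈ l₁ ++ l₂, p + q + s = r) → (∃ p ∈ l₁, ∃ q ∈ l₁, ∃ s ∈ l₁, p + q + s = r) := by
  rintro ⟨p, hp, q, hq, s, hs, hpqs⟩
  rw [List.mem_append] at hp hq hs
  rcases hp with hp | hp
  · rcases hq with hq | hq
    · rcases hs with hs | hs
      · exact ⟨p, hp, q, hq, s, hs, hpqs⟩
      · have := hx s hs; omega
    · have := hx q hq; omega
  · have := hx p hp; omega

set_option synthInstance.maxSize 2000000 in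
set_option synthInstance.maxHeartbeats 2000000 in
set_option maxHeartbeats 4000000 in
/-- **Finite core of `σ(3,4) = 30`** (pruned nested enumeration over `0 < a < b < c < 34`, `decide` in the kernel): if the sorted prefixes keep the
step-≤-2 TRIPLE-sum chain alive and the chain of `{0,a,b,c}` reaches `29`, then `31` is not a triple sum and `30`, `32` are not both. [folklore] -/
theorem sectorCheck_three_four :
    ∀ a ∈ List.range 34, (0 < a ∧ (∀ r ∈ List.range (min 30 (a - 1)), (∃ x ∈ [0], ∃ y ∈ [0], ∃ z ∈ [0], x + y + z = r) ∨ (∃ x ∈ [0], ∃ y ∈ [0], ∃ z ∈ [0], x + y + z = r + 1))) →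
    ∀ b ∈ List.range 34, (a < b ∧ (∀ r ∈ List.range (min 30 (b - 1)), (∃ x ∈ [0, a], ∃ y ∈ [0, a], ∃ z ∈ [0, a], x + y + z = r) ∨ (∃ x ∈ [0, a], ∃ y ∈ [0, a], ∃ z ∈ [0, a], x + y + z = r + 1))) →
    ∀ c ∈ List.range 34, (b < c ∧ (∀ r ∈ List.range (min 30 (c - 1)), (∃ x ∈ [0, a, b], ∃ y ∈ [0, a, b], ∃ z ∈ [0, a, b], x + y + z = r) ∨ (∃ x ∈ [0, a, b], ∃ y ∈ [0, a, b], ∃ z ∈ [0, a, b], x + y + z = r + 1))) →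
    ((∀ r ∈ List.range (30), (∃ x ∈ [0, a, b, c], ∃ y ∈ [0, a, b, c], ∃ z ∈ [0, a, b, c], x + y + z = r) ∨ (∃ x ∈ [0, a, b, c], ∃ y ∈ [0, a, b, c], ∃ z ∈ [0, a, b, c], x + y + z = r + 1)) → (¬ (∃ x ∈ [0, a, b, c], ∃ y ∈ [0, a, b, c], ∃ z ∈ [0, a, b, c], x + y + z = 31) ∧ ¬ ((∃ x ∈ [0, a, b, c], ∃ y ∈ [0, a, b, c], ∃ z ∈ [0, a, b, c], x + y + z = 30) ∧ (∃ x ∈ [0, a, b, c], ∃ y ∈ [0, a, b, c], ∃ z ∈ [0, a, b, c], x + y + z = 32)))) := by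
  decide +kernel

/-- **`η(3,4) ≤ 30 = σ(3,4)`**: every in-sector determinant of a real symmetric `3 × 3` lacunary pencil with `4` terms has degree `≤ 30` —
`HypRootLawAt 3 4 30`. [folklore] -/
theorem hypRootLawAt_three_four_30 : HypRootLawAt 3 4 30 := by
  intro d S hS hsec
  by_contra hdeg'
  have hdeg : 30 < (pencil d S).det.natDegree := not_le.mp hdeg'
  have hq : (pencil d S).det ≠ 0 := by
    intro h0
    rw [h0] at hdeg
    simp at hdeg
  have hpair : ∀ r, r ∈ (Finset.univ : Finset (Sym (Fin 4) 3)).image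
      (fun s : Sym (Fin 4) 3 => ((s : Multiset (Fin 4)).map d).sum) → ∃ i j k : Fin 4, d i + d j + d k = r := by
    intro r hr
    rw [Finset.mem_image] at hr
    obtain ⟨s, -, hs⟩ := hr
    have hcard3 : Multiset.card (s : Multiset (Fin 4)) = 3 := s.2
    obtain ⟨i, j, k, hijk⟩ := Multiset.card_eq_three.mp hcard3
    refine ⟨i, j, k, ?_⟩
    have hsum : ((s : Multiset (Fin 4)).map d).sum = d i + d j + d k := by
      rw [hijk]
      simp [add_assoc]
    omega
  have hchain : ∀ r, r + 2 ≤ (pencil d S).det.natDegree →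
      (∃ i j k : Fin 4, d i + d j + d k = r) ∨ (∃ i j k : Fin 4, d i + d j + d k = r + 1) := by
    intro r hr
    rcases sieve d S hq hsec hr with h | h
    · exact Or.inl (hpair _ h)
    · exact Or.inr (hpair _ h)
  have htop : ∃ i j k : Fin 4, d i + d j + d k = (pencil d S).det.natDegree := hpair _ (natDegree_mem_sumset d S hq)
  set cv : Fin 4 → ℕ := fun i => min (d i) 33 with hcv
  have hcvd : ∀ i, d i ≤ 32 → cv i = d i := fun i hi => by
    simp only [hcv]
    exact Nat.min_eq_left (by omega)
  have hcvle : ∀ i, cv i ≤ 33 := fun i => Nat.min_le_right _ _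
  set V : Finset ℕ := Finset.univ.image cv with hV
  have hcvV : ∀ i, cv i ∈ V := fun i => Finset.mem_image_of_mem cv (Finset.mem_univ i)
  have h0V : 0 ∈ V := by
    rcases hchain 0 (by omega) with ⟨i, j, k, h⟩ | ⟨i, j, k, h⟩
    · have : cv i = 0 := by rw [hcvd i (by omega)]; omega
      exact this ▸ hcvV i
    · rcases Nat.eq_zero_or_pos (d i) with hi | hi
      · have : cv i = 0 := by rw [hcvd i (by omega)]; omega
        exact this ▸ hcvV i
      · have : cv j = 0 := by rw [hcvd j (by omega)]; omega
        exact this ▸ hcvV j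
  set W : Finset ℕ := V.erase 0 with hW
  have hWsub : W ⊆ (Finset.range 34).erase 0 := by
    intro u hu
    rw [hW, Finset.mem_erase] at hu
    obtain ⟨hu0, huV⟩ := hu
    rw [hV, Finset.mem_image] at huV
    obtain ⟨i, -, rfl⟩ := huV
    rw [Finset.mem_erase, Finset.mem_range]
    exact ⟨hu0, Nat.lt_succ_of_le (hcvle i)⟩
  have hWcard : W.card ≤ 3 := by
    have hVK : V.card ≤ 4 := by
      have := Finset.card_image_le (s := (Finset.univ : Finset (Fin 4))) (f := cv)
      simpa using this
    have h1 : W.card + 1 = V.card := by rw [hW]; exact Finset.card_erase_add_one h0V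
    omega
  obtain ⟨W', hWW', hW'sub, hW'card⟩ := Finset.exists_subsuperset_card_eq hWsub hWcard
    (by rw [Finset.card_erase_of_mem (by simp), Finset.card_range]; omega)
  have hVW' : ∀ u ∈ V, u = 0 ∨ u ∈ W' := by
    intro u hu
    by_cases hu0 : u = 0
    · exact Or.inl hu0
    · exact Or.inr (hWW' (by rw [hW, Finset.mem_erase]; exact ⟨hu0, hu⟩))
  have hlmem : ∀ u, u ∈ Finset.sort W' ↔ u ∈ W' := fun u => Finset.mem_sort _
  have hlsort : (Finset.sort W').SortedLT := Finset.sortedLT_sort W'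
  have hllen : (Finset.sort W').length = 3 := by rw [Finset.length_sort, hW'card]
  generalize hl : Finset.sort W' = l at hlmem hlsort hllen
  rcases l with _ | ⟨a, _ | ⟨b, _ | ⟨c, _ | ⟨zz, ll⟩⟩⟩⟩
  all_goals simp only [List.length_cons, List.length_nil] at hllen
  all_goals try omega
  have hmemR : ∀ u, u ∈ [a, b, c] → u ∈ List.range 34 := by
    intro u hu
    have hu' : u ∈ W' := (hlmem u).mp hu
    have := hW'sub hu'
    rw [Finset.mem_erase, Finset.mem_range] at this
    exact List.mem_range.mpr this.2
  have hne0 : ∀ u, u ∈ [a, b, c] → u ≠ 0 := by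
    intro u hu
    have hu' : u ∈ W' := (hlmem u).mp hu
    have := hW'sub hu'
    rw [Finset.mem_erase] at this
    exact this.1
  have h0 : 0 < a := Nat.pos_of_ne_zero (hne0 a (by simp))
  have hmemP : ∀ r, r ≤ 32 → (∃ i j k : Fin 4, d i + d j + d k = r) → (∃ x ∈ [0, a, b, c], ∃ y ∈ [0, a, b, c], ∃ z ∈ [0, a, b, c], x + y + z = r) := by
    rintro r hr ⟨i, j, k, hijk⟩
    have hi : cv i = d i := hcvd i (by omega)
    have hj : cv j = d j := hcvd j (by omega)
    have hk : cv k = d k := hcvd k (by omega)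
    have hin : ∀ u ∈ V, u ∈ [0, a, b, c] := by
      intro u hu
      rcases hVW' u hu with h | h
      · rw [h]; simp
      · exact List.mem_cons_of_mem _ ((hlmem u).mpr h)
    exact ⟨cv i, hin _ (hcvV i), cv j, hin _ (hcvV j), cv k, hin _ (hcvV k), by rw [hi, hj, hk]; exact hijk⟩
  have hchainP : ∀ r, r ≤ 29 → (∃ x ∈ [0, a, b, c], ∃ y ∈ [0, a, b, c], ∃ z ∈ [0, a, b, c], x + y + z = r) ∨ (∃ x ∈ [0, a, b, c], ∃ y ∈ [0, a, b, c], ∃ z ∈ [0, a, b, c], x + y + z = r + 1) := by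
    intro r hr
    rcases hchain r (by omega) with h | h
    · exact Or.inl (hmemP r (by omega) h)
    · exact Or.inr (hmemP (r + 1) (by omega) h)
  have hfull : (∀ r ∈ List.range (30), (∃ x ∈ [0, a, b, c], ∃ y ∈ [0, a, b, c], ∃ z ∈ [0, a, b, c], x + y + z = r) ∨ (∃ x ∈ [0, a, b, c], ∃ y ∈ [0, a, b, c], ∃ z ∈ [0, a, b, c], x + y + z = r + 1)) := fun r hr => hchainP r (by have := List.mem_range.mp hr; omega)
  have hlt1 : a < b := by
    have := hlsort (show (⟨0, by simp⟩ : Fin [a, b, c].length) < ⟨1, by simp⟩ from Fin.mk_lt_mk.mpr (by norm_num))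
    simpa using this
  have hlt2 : b < c := by
    have := hlsort (show (⟨1, by simp⟩ : Fin [a, b, c].length) < ⟨2, by simp⟩ from Fin.mk_lt_mk.mpr (by norm_num))
    simpa using this
  have pre1 : (∀ r ∈ List.range (min 30 (a - 1)), (∃ x ∈ [0], ∃ y ∈ [0], ∃ z ∈ [0], x + y + z = r) ∨ (∃ x ∈ [0], ∃ y ∈ [0], ∃ z ∈ [0], x + y + z = r + 1)) := by
    intro r hr
    rw [List.mem_range] at hr
    have hrT : r < 30 := lt_of_lt_of_le hr (min_le_left _ _)
    have hrv : r < a - 1 := lt_of_lt_of_le hr (min_le_right _ _)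
    have hr' : r + 1 < a := by omega
    have hrest : ∀ y ∈ [a, b, c], a ≤ y := by
      intro y hy
      simp only [List.mem_cons, List.mem_nil_iff, or_false] at hy
      omega
    rcases hchainP r (by omega) with h | h
    · exact Or.inl (memP3_prefix (l₁ := [0]) (l₂ := [a, b, c]) hrest (by omega) h)
    · exact Or.inr (memP3_prefix (l₁ := [0]) (l₂ := [a, b, c]) hrest hr' h)
  have pre2 : (∀ r ∈ List.range (min 30 (b - 1)), (∃ x ∈ [0, a], ∃ y ∈ [0, a], ∃ z ∈ [0, a], x + y + z = r) ∨ (∃ x ∈ [0, a], ∃ y ∈ [0, a], ∃ z ∈ [0, a], x + y + z = r + 1)) := by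
    intro r hr
    rw [List.mem_range] at hr
    have hrT : r < 30 := lt_of_lt_of_le hr (min_le_left _ _)
    have hrv : r < b - 1 := lt_of_lt_of_le hr (min_le_right _ _)
    have hr' : r + 1 < b := by omega
    have hrest : ∀ y ∈ [b, c], b ≤ y := by
      intro y hy
      simp only [List.mem_cons, List.mem_nil_iff, or_false] at hy
      omega
    rcases hchainP r (by omega) with h | h
    · exact Or.inl (memP3_prefix (l₁ := [0, a]) (l₂ := [b, c]) hrest (by omega) h)
    · exact Or.inr (memP3_prefix (l₁ := [0, a]) (l₂ := [b, c]) hrest hr' h)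
  have pre3 : (∀ r ∈ List.range (min 30 (c - 1)), (∃ x ∈ [0, a, b], ∃ y ∈ [0, a, b], ∃ z ∈ [0, a, b], x + y + z = r) ∨ (∃ x ∈ [0, a, b], ∃ y ∈ [0, a, b], ∃ z ∈ [0, a, b], x + y + z = r + 1)) := by
    intro r hr
    rw [List.mem_range] at hr
    have hrT : r < 30 := lt_of_lt_of_le hr (min_le_left _ _)
    have hrv : r < c - 1 := lt_of_lt_of_le hr (min_le_right _ _)
    have hr' : r + 1 < c := by omega
    have hrest : ∀ y ∈ [c], c ≤ y := by
      intro y hy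
      simp only [List.mem_cons, List.mem_nil_iff, or_false] at hy
      omega
    rcases hchainP r (by omega) with h | h
    · exact Or.inl (memP3_prefix (l₁ := [0, a, b]) (l₂ := [c]) hrest (by omega) h)
    · exact Or.inr (memP3_prefix (l₁ := [0, a, b]) (l₂ := [c]) hrest hr' h)
  obtain ⟨hno31, hno3032⟩ := sectorCheck_three_four a (hmemR a (by simp)) ⟨h0, pre1⟩ b (hmemR b (by simp)) ⟨hlt1, pre2⟩ c (hmemR c (by simp)) ⟨hlt2, pre3⟩ hfull
  rcases Nat.lt_or_ge (pencil d S).det.natDegree 33 with hsmall | hbig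
  · interval_cases h : (pencil d S).det.natDegree
    · exact hno31 (hmemP 31 (by omega) (h ▸ htop))
    · have h32 : (∃ x ∈ [0, a, b, c], ∃ y ∈ [0, a, b, c], ∃ z ∈ [0, a, b, c], x + y + z = 32) := hmemP 32 (by omega) (h ▸ htop)
      rcases hchain 30 (by omega) with h' | h'
      · exact hno3032 ⟨hmemP 30 (by omega) h', h32⟩
      · exact hno31 (hmemP 31 (by omega) h')
  · rcases hchain 30 (by omega) with h1 | h1
    · rcases hchain 31 (by omega) with h2 | h2
      · exact hno31 (hmemP 31 (by omega) h2)
      · exact hno3032 ⟨hmemP 30 (by omega) h1, hmemP 32 (by omega) h2⟩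
    · exact hno31 (hmemP 31 (by omega) h1)

end Summit.ValiantsHypothesis.ValiantsHypothesis.Theorems.LacunarySymmetroidMatrixDescartes.FiniteSector
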